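import Mathlib.Topology.Order.ProjIcc
import Mathlib.Topology.Order.IntermediateValue
import Mathlib.Topology.Sequences
import Mathlib.Analysis.SpecificLimits.Basic
import Summits.CriticalPhenomena.CardyFormulaZ2.Theorems.CardyBoundaryCoulombGasRectilinearSufficesApprox
import Literature.Probability.RandomPlanarGeometry.CrossRatioContinuity
import Literature.Probability.RandomPlanarGeometry.ConformalRectangleProofs
import HarnessLib

/-!
# Stub S3 `stub_rectilinearRealisation`: exact-modulus rectilinear approximants

Support file for the crux `BoxFamilyToCardy` (stmt-CriticalPhenomena-14215, route
`CardyWickAnisotropy` of `CardyFormulaZ2`); the same stub, with the same name and signature, is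
registered on the sibling crux `ConfInvTransport` (stmt-CriticalPhenomena-0794). Proved here, from
tree theorems only:

* `stub_rectilinearRealisation`: for every conformal rectangle `R` with a uniformizing datum
  `(φ, x)` and every `ε₀ > 0` there is a RECTILINEAR conformal rectangle `Q` (Jordan boundary inside
  finitely many axis-parallel segments) with a uniformizing datum `(ψ, y)` such that the boundary
  loop of `Q` is pointwise `ε₀`-close to that of `R` (as `1`-periodic parametrised loops), the mark
  parameters are `ε₀`-close, and `crossRatio y = crossRatio x` EXACTLY.

Proof (pure conformal geometry, no percolation).
1. `Theorems.exists_rectilinear_close` gives rectilinear `Pₙ` with the SAME marks as `R` and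
   boundary loop `min ε₀ (1/(n+1))`-close to `R.boundary`, hence uniformly convergent to it.
2. *Re-marking* (`exists_remark`): moving the second mark parameter of a conformal rectangle `D`
   to any `s ∈ (D.mark 0, D.mark 2)` gives a conformal rectangle `D⟨s⟩` on the same Jordan domain.
3. *The modulus is strictly increasing in the second mark* (`crossRatio_lt_of_mark_lt`): for
   `D.mark 0 < s < t < D.mark 2`, uniformizing the FIVE-marked domain `(D; mark 0, s, t, mark 2,
   mark 3)` (`MarkedDomain.exists_isUniformizing_holds (n := 5)`) gives one conformal map `φ` and
   reals `x₀ < x₁ < x₂ < x₃ < x₄` (or decreasing) serving both `D⟨s⟩` (drop `x₂`) and `D⟨t⟩` (drop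
   `x₁`); Cardy's cross-ratio `(x₀-b)(x₃-x₄)/((x₀-x₃)(b-x₄))` is strictly increasing in
   `b ∈ (x₀, x₃)` (`crossRatio_succAbove_lt`), and the modulus does not depend on the datum
   (`ConformalRectangle.crossRatio_eq_of_isUniformizing_holds`). Hence, for a small window
   `s⁻ < R.mark 1 < s⁺`: `η(R⟨s⁻⟩) < η(R) < η(R⟨s⁺⟩)`.
4. *Radó* (`ConformalRectangle.tendsto_crossRatio_of_tendsto_mark`): `η(Pₙ⟨s±⟩) → η(R⟨s±⟩)`, so
   some `Pₙ` has `η(Pₙ⟨s⁻⟩) < η(R) < η(Pₙ⟨s⁺⟩)`; with the constant loop sequence the same theorem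
   makes `s ↦ η(Pₙ⟨s⟩)` continuous on `[s⁻, s⁺]`, and the intermediate value theorem
   (`intermediate_value_Icc`) yields `s* ∈ [s⁻, s⁺]` with `η(Pₙ⟨s*⟩) = η(R)`; `Q := Pₙ⟨s*⟩`.

No definitions; the re-marked domains are produced by the existence lemma `exists_remark` and
chosen with `choose`.

References: Ch. Pommerenke, *Boundary Behaviour of Conformal Maps* (1992), Thm. 2.6, Cor. 2.7,
§2.3 Thm. 2.11 (Radó) and Exercise 2 (modulus of a quadrilateral); L. V. Ahlfors, *Complex
Analysis*, 3rd ed. (1979), Ch. 3 §3.1 (cross-ratio).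
-/

noncomputable section

open Filter Topology Set
open UpperHalfPlane (upperHalfPlaneSet)
open Literature.Probability.RandomPlanarGeometry

namespace Summit.CriticalPhenomena.CardyFormulaZ2.Cruxes.BoxFamilyToCardy.Birth

/-! ## Cardy's cross-ratio is strictly increasing in its second point -/

/-- **Monotonicity of Cardy's cross-ratio in the second point.** For reals
`x₀ < x₁ < x₂ < x₃ < x₄`, dropping `x₂` gives a smaller cross-ratio than dropping `x₁`:
`η(x₀, x₁, x₃, x₄) < η(x₀, x₂, x₃, x₄)`, because `η(x₀, b, x₃, x₄) = K (b - x₀)/(x₄ - b)` with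
`K = (x₄ - x₃)/(x₃ - x₀) > 0` is strictly increasing in `b ∈ (x₀, x₃)`. Ahlfors (1979), Ch. 3 §3.1.
[folklore] -/
theorem crossRatio_succAbove_lt {x : Fin 5 → ℝ} (hx : StrictMono x) :
    crossRatio (x ∘ Fin.succAbove 2) < crossRatio (x ∘ Fin.succAbove 1) := by
  have e20 : Fin.succAbove (2 : Fin 5) 0 = 0 := by decide
  have e21 : Fin.succAbove (2 : Fin 5) 1 = 1 := by decide
  have e22 : Fin.succAbove (2 : Fin 5) 2 = 3 := by decide
  have e23 : Fin.succAbove (2 : Fin 5) 3 = 4 := by decide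
  have e10 : Fin.succAbove (1 : Fin 5) 0 = 0 := by decide
  have e11 : Fin.succAbove (1 : Fin 5) 1 = 2 := by decide
  have e12 : Fin.succAbove (1 : Fin 5) 2 = 3 := by decide
  have e13 : Fin.succAbove (1 : Fin 5) 3 = 4 := by decide
  simp only [crossRatio, Function.comp_apply, e20, e21, e22, e23, e10, e11, e12, e13]
  have h01 : x 0 < x 1 := hx (by decide)
  have h12 : x 1 < x 2 := hx (by decide)
  have h23 : x 2 < x 3 := hx (by decide)
  have h34 : x 3 < x 4 := hx (by decide)
  have hd1 : 0 < (x 0 - x 3) * (x 1 - x 4) := by nlinarith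
  have hd2 : 0 < (x 0 - x 3) * (x 2 - x 4) := by nlinarith
  rw [div_lt_div_iff₀ hd1 hd2]
  have hK : 0 < (x 3 - x 4) * (x 0 - x 3) := by nlinarith
  have key : (x 0 - x 1) * (x 2 - x 4) < (x 0 - x 2) * (x 1 - x 4) := by nlinarith
  nlinarith [mul_lt_mul_of_pos_left key hK]

/-! ## Re-marking a conformal rectangle -/

/-- **Re-marking.** For a conformal rectangle `D` and a parameter `s` strictly between
`D.mark 0` and `D.mark 2` there is a conformal rectangle on the SAME Jordan domain (same carrier,
same boundary loop) with mark parameters `(D.mark 0, s, D.mark 2, D.mark 3)`: only the second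
marked point moves, along the boundary arc between the first and the third. [folklore] -/
theorem exists_remark (D : ConformalRectangle) {s : ℝ} (h0 : D.mark 0 < s) (h2 : s < D.mark 2) :
    ∃ D' : ConformalRectangle, D'.toJordanDomain = D.toJordanDomain ∧
      D'.mark = ![D.mark 0, s, D.mark 2, D.mark 3] := by
  have h23 : D.mark 2 < D.mark 3 := D.strictMono_mark (by decide)
  have h00 : 0 ≤ D.mark 0 := (D.mark_mem 0).1
  have h21 : D.mark 2 < 1 := (D.mark_mem 2).2
  refine ⟨⟨D.toJordanDomain, ![D.mark 0, s, D.mark 2, D.mark 3], ?_, ?_⟩, rfl, rfl⟩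
  · refine Fin.strictMono_iff_lt_succ.2 fun k ↦ ?_
    fin_cases k
    · exact h0
    · exact h2
    · exact h23
  · intro k
    fin_cases k
    · exact D.mark_mem 0
    · show s ∈ Ico (0 : ℝ) 1
      exact ⟨h00.trans h0.le, h2.trans h21⟩
    · exact D.mark_mem 2
    · exact D.mark_mem 3

/-! ## The modulus is strictly increasing in the second mark -/

/-- **Strict monotonicity of the conformal modulus in one marked point.** Let `D` be a conformal
rectangle and `Ds = D⟨s⟩`, `Dt = D⟨t⟩` the re-marked rectangles (same Jordan domain, mark
parameters `(D.mark 0, s, D.mark 2, D.mark 3)` and `(D.mark 0, t, D.mark 2, D.mark 3)`) with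
`s < t`. Then the Cardy cross-ratio of ANY uniformizing datum of `Ds` is strictly smaller than that
of any uniformizing datum of `Dt`. Proof: uniformize the five-marked domain
`(D; mark 0, s, t, mark 2, mark 3)` (`MarkedDomain.exists_isUniformizing_holds`, Riemann mapping +
Carathéodory, Pommerenke (1992), Thm. 2.6 and Cor. 2.7); the same conformal map with four of the
five real preimages uniformizes `Ds` (drop the third) and `Dt` (drop the second), the modulus is
datum-independent (`ConformalRectangle.crossRatio_eq_of_isUniformizing_holds`), and the
cross-ratio is strictly increasing in its second point (`crossRatio_succAbove_lt`; the antitone case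
by `crossRatio_neg`). [cite: PommerenkeBBCM1992, Thm. 2.6, Cor. 2.7 and §2.3 Exercise 2] -/
theorem crossRatio_lt_of_mark_lt {D Ds Dt : ConformalRectangle} {s t : ℝ}
    (hsJ : Ds.toJordanDomain = D.toJordanDomain)
    (hsm : Ds.mark = ![D.mark 0, s, D.mark 2, D.mark 3])
    (htJ : Dt.toJordanDomain = D.toJordanDomain)
    (htm : Dt.mark = ![D.mark 0, t, D.mark 2, D.mark 3]) (hst : s < t)
    {φs : ConformalEquiv upperHalfPlaneSet Ds.carrier} {xs : Fin 4 → ℝ}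
    (hus : Ds.IsUniformizing φs xs)
    {φt : ConformalEquiv upperHalfPlaneSet Dt.carrier} {xt : Fin 4 → ℝ}
    (hut : Dt.IsUniformizing φt xt) :
    crossRatio xs < crossRatio xt := by
  have h0s : D.mark 0 < s := by
    have := Ds.strictMono_mark (show (0 : Fin 4) < 1 by decide)
    rw [hsm] at this
    exact this
  have ht2 : t < D.mark 2 := by
    have := Dt.strictMono_mark (show (1 : Fin 4) < 2 by decide)
    rw [htm] at this
    exact this
  have h23 : D.mark 2 < D.mark 3 := D.strictMono_mark (by decide)
  have h00 : 0 ≤ D.mark 0 := (D.mark_mem 0).1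
  have h21 : D.mark 2 < 1 := (D.mark_mem 2).2
  have hmono5 : StrictMono ![D.mark 0, s, t, D.mark 2, D.mark 3] := by
    refine Fin.strictMono_iff_lt_succ.2 fun k ↦ ?_
    fin_cases k
    · exact h0s
    · exact hst
    · exact ht2
    · exact h23
  have hmem5 : ∀ k, ![D.mark 0, s, t, D.mark 2, D.mark 3] k ∈ Ico (0 : ℝ) 1 := by
    intro k
    fin_cases k
    · exact D.mark_mem 0
    · show s ∈ Ico (0 : ℝ) 1
      exact ⟨h00.trans h0s.le, (hst.trans ht2).trans h21⟩
    · show t ∈ Ico (0 : ℝ) 1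
      exact ⟨(h00.trans h0s.le).trans hst.le, ht2.trans h21⟩
    · exact D.mark_mem 2
    · exact D.mark_mem 3
  -- normalise `Ds`, `Dt` to structure literals over `D.toJordanDomain`
  obtain ⟨Js, ms, ps, qs⟩ := Ds
  obtain ⟨Jt, mt, pt, qt⟩ := Dt
  dsimp only at hsJ hsm htJ htm
  subst hsJ hsm htJ htm
  -- the five-marked domain and its uniformizing datum
  obtain ⟨φ, x, hx, hbv⟩ := MarkedDomain.exists_isUniformizing_holds
    (⟨D.toJordanDomain, ![D.mark 0, s, t, D.mark 2, D.mark 3], hmono5, hmem5⟩ : MarkedDomain 5)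
  -- the same map uniformizes the two four-marked domains
  have hus' : MarkedDomain.IsUniformizing
      (⟨D.toJordanDomain, ![D.mark 0, s, D.mark 2, D.mark 3], ps, qs⟩ : ConformalRectangle) φ
      (x ∘ Fin.succAbove 2) := by
    refine ⟨hx.imp (fun h ↦ h.comp (Fin.strictMono_succAbove 2))
      (fun h ↦ h.comp_strictMono (Fin.strictMono_succAbove 2)), fun i ↦ ?_⟩
    fin_cases i
    · exact hbv 0
    · exact hbv 1
    · exact hbv 3
    · exact hbv 4
  have hut' : MarkedDomain.IsUniformizing
      (⟨D.toJordanDomain, ![D.mark 0, t, D.mark 2, D.mark 3], pt, qt⟩ : ConformalRectangle) φ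
      (x ∘ Fin.succAbove 1) := by
    refine ⟨hx.imp (fun h ↦ h.comp (Fin.strictMono_succAbove 1))
      (fun h ↦ h.comp_strictMono (Fin.strictMono_succAbove 1)), fun i ↦ ?_⟩
    fin_cases i
    · exact hbv 0
    · exact hbv 2
    · exact hbv 3
    · exact hbv 4
  rw [ConformalRectangle.crossRatio_eq_of_isUniformizing_holds hus hus',
    ConformalRectangle.crossRatio_eq_of_isUniformizing_holds hut hut']
  rcases hx with hx | hx
  · exact crossRatio_succAbove_lt hx
  · rw [← crossRatio_neg (x ∘ Fin.succAbove 2), ← crossRatio_neg (x ∘ Fin.succAbove 1)]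
    exact crossRatio_succAbove_lt hx.neg

/-! ## The stub -/

/-- **Stub S3 `stub_rectilinearRealisation`** (registered on the cruxes stmt-CriticalPhenomena-14215
`BoxFamilyToCardy` and stmt-CriticalPhenomena-0794 `ConfInvTransport`, same name and signature).
For every conformal rectangle `R` with a uniformizing datum `(φ, x)` and every `ε₀ > 0` there is
a RECTILINEAR conformal rectangle `Q` (frontier inside finitely many axis-parallel segments) with
a uniformizing datum `(ψ, y)` such that the boundary loop of `Q` is pointwise `ε₀`-close to that
of `R`, the mark parameters are `ε₀`-close, and `crossRatio y = crossRatio x` EXACTLY. Proof: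
rectilinear approximants `Pₙ` with the same marks and uniformly convergent boundary loops
(`Theorems.exists_rectilinear_close`); a window `s⁻ < R.mark 1 < s⁺` of half-width `≤ ε₀` in
which the modulus of the re-marked `R` brackets `η(R)` strictly (`crossRatio_lt_of_mark_lt`); by
Radó (`ConformalRectangle.tendsto_crossRatio_of_tendsto_mark`) the bracketing passes to `Pₙ` for
some `n`, and the modulus of `Pₙ⟨s⟩` is continuous in `s`, so the intermediate value theorem
gives `s* ∈ [s⁻, s⁺]` with `η(Pₙ⟨s*⟩) = η(R)`; `Q := Pₙ⟨s*⟩`. Pommerenke (1992), Thm. 2.6,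
Cor. 2.7, Thm. 2.11. [cite: PommerenkeBBCM1992, Thm. 2.11 and Cor. 2.4] -/
theorem stub_rectilinearRealisation :
    ∀ (R : Literature.Probability.RandomPlanarGeometry.ConformalRectangle) (φ : Literature.Probability.RandomPlanarGeometry.ConformalEquiv UpperHalfPlane.upperHalfPlaneSet R.carrier) (x : Fin 4 → ℝ), R.IsUniformizing φ x → ∀ ε₀ : ℝ, 0 < ε₀ → ∃ (Q : Literature.Probability.RandomPlanarGeometry.ConformalRectangle) (ψ : Literature.Probability.RandomPlanarGeometry.ConformalEquiv UpperHalfPlane.upperHalfPlaneSet Q.carrier) (y : Fin 4 → ℝ), (∃ S : Finset (ℂ × ℂ), (∀ p ∈ S, p.1.re = p.2.re ∨ p.1.im = p.2.im) ∧ frontier Q.carrier ⊆ ⋃ p ∈ S, segment ℝ p.1 p.2) ∧ Q.IsUniformizing ψ y ∧ (∀ u : ℝ, dist (Q.boundary u) (R.boundary u) ≤ ε₀) ∧ (∀ i : Fin 4, |Q.mark i - R.mark i| ≤ ε₀) ∧ Literature.Probability.RandomPlanarGeometry.crossRatio y = Literature.Probability.RandomPlanarGeometry.crossRatio x := by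
  intro R φ x hφ ε₀ hε₀
  -- (0) the window `[sl, su] = [R.mark 1 - ε', R.mark 1 + ε']` around `R.mark 1`
  have h01 : R.mark 0 < R.mark 1 := R.strictMono_mark (by decide)
  have h12 : R.mark 1 < R.mark 2 := R.strictMono_mark (by decide)
  obtain ⟨ε', hε'0, hε'ε, hε'1, hε'2⟩ : ∃ ε' : ℝ, 0 < ε' ∧ ε' ≤ ε₀ ∧
      ε' ≤ (R.mark 1 - R.mark 0) / 2 ∧ ε' ≤ (R.mark 2 - R.mark 1) / 2 :=
    ⟨min ε₀ (min ((R.mark 1 - R.mark 0) / 2) ((R.mark 2 - R.mark 1) / 2)),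
      lt_min hε₀ (lt_min (by linarith) (by linarith)), min_le_left _ _,
      (min_le_right _ _).trans (min_le_left _ _), (min_le_right _ _).trans (min_le_right _ _)⟩
  set sl : ℝ := R.mark 1 - ε' with hsl
  set su : ℝ := R.mark 1 + ε' with hsu
  have h0l : R.mark 0 < sl := by rw [hsl]; linarith
  have hl1 : sl < R.mark 1 := by rw [hsl]; linarith
  have h1u : R.mark 1 < su := by rw [hsu]; linarith
  have hu2 : su < R.mark 2 := by rw [hsu]; linarith
  have hle : sl ≤ su := (hl1.trans h1u).le
  -- (1) strict bracketing of `η(R)` by the re-marked `R`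
  have hRm : R.mark = ![R.mark 0, R.mark 1, R.mark 2, R.mark 3] := by
    funext i
    fin_cases i <;> rfl
  obtain ⟨Rl, hRlJ, hRlm⟩ := exists_remark R h0l (hl1.trans h12)
  obtain ⟨Ru, hRuJ, hRum⟩ := exists_remark R (h01.trans h1u) hu2
  obtain ⟨φl, xl, hul⟩ := MarkedDomain.exists_isUniformizing_holds Rl
  obtain ⟨φu, xu, huu⟩ := MarkedDomain.exists_isUniformizing_holds Ru
  have hlow : crossRatio xl < crossRatio x :=
    crossRatio_lt_of_mark_lt hRlJ hRlm rfl hRm hl1 hul hφ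
  have hupp : crossRatio x < crossRatio xu :=
    crossRatio_lt_of_mark_lt rfl hRm hRuJ hRum h1u hφ huu
  -- (2) rectilinear approximants with the same marks, boundary loops uniformly convergent
  choose P hPm hPrect hPd using fun n : ℕ ↦
    Summit.CriticalPhenomena.CardyFormulaZ2.Theorems.exists_rectilinear_close R
      (ε := min ε₀ (1 / ((n : ℝ) + 1))) (by positivity)
  have hJ : TendstoUniformly (fun n ↦ (P n).boundary) R.boundary atTop := by
    rw [Metric.tendstoUniformly_iff]
    intro δ hδ
    have h1 : ∀ᶠ n : ℕ in atTop, 1 / ((n : ℝ) + 1) < δ :=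
      (tendsto_one_div_add_atTop_nhds_zero_nat (𝕜 := ℝ)).eventually (gt_mem_nhds hδ)
    filter_upwards [h1] with n hn u
    rw [dist_comm]
    exact (hPd n u).trans_lt ((min_le_right _ _).trans_lt hn)
  -- (3) the re-marked approximants `P n ⟨p⟩`, `p ∈ [sl, su]`, with chosen uniformizing data
  have hex : ∀ (n : ℕ) (p : Icc sl su), ∃ D' : ConformalRectangle,
      D'.toJordanDomain = (P n).toJordanDomain ∧
        D'.mark = ![(P n).mark 0, (p : ℝ), (P n).mark 2, (P n).mark 3] := fun n p ↦
    exists_remark (P n) (by rw [hPm]; exact h0l.trans_le p.2.1)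
      (by rw [hPm]; exact p.2.2.trans_lt hu2)
  choose F hFJ hFm using hex
  have hdat : ∀ (n : ℕ) (p : Icc sl su), ∃ (ψ' : ConformalEquiv upperHalfPlaneSet (F n p).carrier)
      (y' : Fin 4 → ℝ), (F n p).IsUniformizing ψ' y' := fun n p ↦
    MarkedDomain.exists_isUniformizing_holds (F n p)
  choose ψF yF hF using hdat
  have hFb : ∀ n p, (F n p).boundary = (P n).boundary := fun n p ↦
    congrArg JordanDomain.boundary (hFJ n p)
  have hFm' : ∀ n p, (F n p).mark = ![R.mark 0, (p : ℝ), R.mark 2, R.mark 3] := fun n p ↦ by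
    rw [hFm, hPm, hPm, hPm]
  have hpl : sl ∈ Icc sl su := left_mem_Icc.2 hle
  have hpu : su ∈ Icc sl su := right_mem_Icc.2 hle
  -- (4) Radó at the two ends of the window: the bracketing passes to some `P n`
  have hRlb : Rl.boundary = R.boundary := congrArg JordanDomain.boundary hRlJ
  have hRub : Ru.boundary = R.boundary := congrArg JordanDomain.boundary hRuJ
  have hliml : Tendsto (fun n ↦ crossRatio (yF n ⟨sl, hpl⟩)) atTop (𝓝 (crossRatio xl)) := by
    refine ConformalRectangle.tendsto_crossRatio_of_tendsto_mark (Q := fun n ↦ F n ⟨sl, hpl⟩)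
      (R := Rl) ?_ (fun i ↦ ?_) (fun n ↦ ψF n ⟨sl, hpl⟩) (fun n ↦ yF n ⟨sl, hpl⟩)
      (fun n ↦ hF n ⟨sl, hpl⟩) φl xl hul
    · simpa only [hFb, hRlb] using hJ
    · have : ∀ n, (F n ⟨sl, hpl⟩).mark i = Rl.mark i := fun n ↦ by rw [hFm', hRlm]
      simp only [this]
      exact tendsto_const_nhds
  have hlimu : Tendsto (fun n ↦ crossRatio (yF n ⟨su, hpu⟩)) atTop (𝓝 (crossRatio xu)) := by
    refine ConformalRectangle.tendsto_crossRatio_of_tendsto_mark (Q := fun n ↦ F n ⟨su, hpu⟩)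
      (R := Ru) ?_ (fun i ↦ ?_) (fun n ↦ ψF n ⟨su, hpu⟩) (fun n ↦ yF n ⟨su, hpu⟩)
      (fun n ↦ hF n ⟨su, hpu⟩) φu xu huu
    · simpa only [hFb, hRub] using hJ
    · have : ∀ n, (F n ⟨su, hpu⟩).mark i = Ru.mark i := fun n ↦ by rw [hFm', hRum]
      simp only [this]
      exact tendsto_const_nhds
  obtain ⟨n, hnl, hnu⟩ : ∃ n, crossRatio (yF n ⟨sl, hpl⟩) < crossRatio x ∧
      crossRatio x < crossRatio (yF n ⟨su, hpu⟩) :=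
    ((hliml.eventually (gt_mem_nhds hlow)).and (hlimu.eventually (lt_mem_nhds hupp))).exists
  -- (5) continuity of the modulus in the moving mark, and the intermediate value theorem
  have hgc : Continuous fun s ↦ crossRatio (yF n (projIcc sl su hle s)) := by
    rw [continuous_iff_seqContinuous]
    intro u s hu
    have hJ' : TendstoUniformly (fun k ↦ (F n (projIcc sl su hle (u k))).boundary)
        (F n (projIcc sl su hle s)).boundary atTop := by
      simp only [hFb]
      exact Metric.tendstoUniformly_iff.2 fun δ hδ ↦ Eventually.of_forall fun k v ↦ by
        simpa using hδ
    have hp : Tendsto (fun k ↦ ((projIcc sl su hle (u k) : Icc sl su) : ℝ)) atTop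
        (𝓝 ((projIcc sl su hle s : Icc sl su) : ℝ)) :=
      ((continuous_subtype_val.comp continuous_projIcc).tendsto s).comp hu
    refine ConformalRectangle.tendsto_crossRatio_of_tendsto_mark hJ' (fun i ↦ ?_)
      (fun k ↦ ψF n (projIcc sl su hle (u k))) (fun k ↦ yF n (projIcc sl su hle (u k)))
      (fun k ↦ hF n _) (ψF n (projIcc sl su hle s)) (yF n (projIcc sl su hle s)) (hF n _)
    simp only [hFm']
    fin_cases i
    · exact tendsto_const_nhds
    · exact hp
    · exact tendsto_const_nhds
    · exact tendsto_const_nhds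
  obtain ⟨sStar, -, hgs⟩ : crossRatio x ∈ (fun s ↦ crossRatio (yF n (projIcc sl su hle s))) ''
      Icc sl su := by
    refine intermediate_value_Icc hle hgc.continuousOn ⟨?_, ?_⟩
    · simp only [projIcc_left]
      exact hnl.le
    · simp only [projIcc_right]
      exact hnu.le
  -- (6) the realisation `Q := P n ⟨sStar⟩`
  have hqI : ((projIcc sl su hle sStar : Icc sl su) : ℝ) ∈ Icc sl su :=
    (projIcc sl su hle sStar).2
  refine ⟨F n (projIcc sl su hle sStar), ψF n _, yF n _, ?_, hF n _, fun u ↦ ?_, fun i ↦ ?_,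
    hgs⟩
  · have hc : (F n (projIcc sl su hle sStar)).carrier = (P n).carrier :=
      congrArg JordanDomain.carrier (hFJ n _)
    rw [hc]
    exact hPrect n
  · rw [hFb]
    exact (hPd n u).trans (min_le_left _ _)
  · rw [hFm']
    fin_cases i
    · show |R.mark 0 - R.mark 0| ≤ ε₀
      simpa using hε₀.le
    · show |((projIcc sl su hle sStar : Icc sl su) : ℝ) - R.mark 1| ≤ ε₀
      rw [abs_le]
      constructor <;> linarith [hqI.1, hqI.2]
    · show |R.mark 2 - R.mark 2| ≤ ε₀
      simpa using hε₀.le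
    · show |R.mark 3 - R.mark 3| ≤ ε₀
      simpa using hε₀.le

end Summit.CriticalPhenomena.CardyFormulaZ2.Cruxes.BoxFamilyToCardy.Birth

end
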